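import Mathlib.AlgebraicGeometry.Morphisms.FormallyUnramified
import Mathlib.AlgebraicGeometry.Morphisms.FiniteType
import Mathlib.RingTheory.Unramified.LocalRing
import Mathlib.RingTheory.RingHom.Unramified
import Mathlib.RingTheory.Spectrum.Prime.Jacobson
import Mathlib.Topology.JacobsonSpace
import HarnessLib

/-!
# Unramifiedness is decided at the closed points of a Jacobson source
# (EGA IV₄ 17.4.1; Stacks Project Tags 02G3, 00UX, 02FM)

Topic `Literature/AlgebraicGeometry/Morphisms`, namespace `Literature.AlgebraicGeometry.Morphisms`.  THEOREMS ONLY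
(no definition, no named fact, no `sorry`).  Cell `hodgecm-mathlib`, fan B-III (T3) = binder I-1′ (item 24835), v4
`stub_S2imm` (Step C of B-plan2's Q-architecture, `B-plan/I1prime-RECEPTACLE-PLAN.md` §7): F1a = the ALGEBRAIC half of
the residual «analytically unramified ⇒ unramified».  Banked leaf; no floor change.

* `RingHom.FormallyUnramified.of_forall_isMaximal` — a ring map `φ : R → A` of finite type with `A` Jacobson is formally
  unramified as soon as `R → A_𝔮` is formally unramified for every MAXIMAL ideal `𝔮` of `A`: the unramified locus is open
  (Mathlib `Algebra.isOpen_unramifiedLocus`) and contains the closed points of the Jacobson space `Spec A`, hence is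
  everything.
* `FormallyUnramified.of_forall_isClosed_stalkMap` — a morphism of schemes `f : X ⟶ Y` locally of finite type with
  JACOBSON source (e.g. `X` locally of finite type over a field) is formally unramified as soon as its stalk maps
  `𝒪_{Y, f x} → 𝒪_{X, x}` at the CLOSED points `x` of `X` are formally unramified.
* `FormallyUnramified.of_forall_isClosed_map_maximalIdeal` — the same with the stalk condition in the form it is
  checked in practice ([Stacks 02FM], Mathlib `Algebra.FormallyUnramified.of_map_maximalIdeal`): at every closed point,
  `𝔪_{f x} 𝒪_{X,x} = 𝔪_x` and `κ(x) / κ(f x)` is separable.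

The analytic half F1b (injective differential of the analytification ⇒ `𝔪_{f x} 𝒪_{X,x} = 𝔪_x` at closed points, via
★ `IsAnalytification.exists_dual_fderiv_coord`) is a separate leaf.

## References
* A. Grothendieck, EGA IV₄ (Publ. Math. IHÉS 32, 1967), Prop. 17.4.1, Cor. 17.4.2. [Grothendieck1967]
* The Stacks Project, Tags 00UX (unramified at a prime), 02G3/039H (unramified morphisms, pointwise), 02FM.
  [StacksProject]
-/

set_option autoImplicit false

universe u

open CategoryTheory AlgebraicGeometry TopologicalSpace

/-! ### §1 Rings: formally unramified at the maximal ideals of a Jacobson algebra of finite type -/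

namespace RingHom.FormallyUnramified

/-- **Formal unramifiedness of a finite-type map into a Jacobson ring is decided at the maximal ideals**: if
`φ : R → A` is of finite type, `A` is Jacobson, and `R → A → A_𝔮` is formally unramified for every maximal ideal `𝔮` of
`A`, then `φ` is formally unramified (the unramified locus of `A / R` is open — Mathlib `Algebra.isOpen_unramifiedLocus` —
and contains every closed point of the Jacobson space `Spec A`, so it is all of `Spec A`; conclude by
`Algebra.formallyUnramified_iff_forall`). [cite: StacksProject, Tag 00UX] [cite: Grothendieck1967, Prop. 17.4.1] -/
theorem of_forall_isMaximal {R A : Type*} [CommRing R] [CommRing A] [IsJacobsonRing A] (φ : R →+* A)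
    (hφ : φ.FiniteType)
    (H : ∀ (q : Ideal A) [q.IsMaximal],
      ((algebraMap A (Localization.AtPrime q)).comp φ).FormallyUnramified) :
    φ.FormallyUnramified := by
  algebraize [φ]
  haveI : Algebra.EssFiniteType R A := Algebra.EssFiniteType.of_finiteType R A
  -- the unramified locus is open and contains the closed points
  have hmax : ∀ q : PrimeSpectrum A, IsClosed ({q} : Set (PrimeSpectrum A)) → q ∈ Algebra.unramifiedLocus R A := by
    intro q hq
    haveI : q.asIdeal.IsMaximal := (PrimeSpectrum.isClosed_singleton_iff_isMaximal q).mp hq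
    have h := H q.asIdeal
    -- `R → A_𝔮` is the structure map of the `R`-algebra `A_𝔮`
    have halg : (algebraMap A (Localization.AtPrime q.asIdeal)).comp (algebraMap R A) =
        algebraMap R (Localization.AtPrime q.asIdeal) :=
      (IsScalarTower.algebraMap_eq R A (Localization.AtPrime q.asIdeal)).symm
    change Algebra.FormallyUnramified R (Localization.AtPrime q.asIdeal)
    rw [← RingHom.formallyUnramified_algebraMap, ← halg]
    exact h
  have huniv : Algebra.unramifiedLocus R A = Set.univ := by
    by_contra hne
    have hZ : (Algebra.unramifiedLocus R A)ᶜ.Nonempty := Set.nonempty_compl.mpr hne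
    have hZ' : IsLocallyClosed (Algebra.unramifiedLocus R A)ᶜ :=
      (Algebra.isOpen_unramifiedLocus (R := R) (A := A)).isClosed_compl.isLocallyClosed
    obtain ⟨q, hqZ, hqcl⟩ := nonempty_inter_closedPoints hZ hZ'
    exact hqZ (hmax q hqcl)
  show Algebra.FormallyUnramified R A
  exact Algebra.unramifiedLocus_eq_univ_iff.mp huniv

end RingHom.FormallyUnramified

/-! ### §2 Schemes: formally unramified at the closed points of a Jacobson source -/

namespace Literature.AlgebraicGeometry.Morphisms

variable {X Y : Scheme.{u}} (f : X ⟶ Y)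

/-- On an affine open `V` of `X`, the composite `Γ(Y, U) → Γ(X, V) → 𝒪_{X,x}` of `f.appLE U V e` with the germ at
`x ∈ V` is the composite `Γ(Y, U) → 𝒪_{Y, f x} → 𝒪_{X, x}` of the germ with the stalk map (Mathlib
`Scheme.Hom.germ_stalkMap`). [cite: StacksProject, Tag 02G3] -/
theorem appLE_comp_germ_eq (U : Y.Opens) (V : X.Opens) (e : V ≤ f ⁻¹ᵁ U) (x : X) (hx : x ∈ V) :
    f.appLE U V e ≫ X.presheaf.germ V x hx = Y.presheaf.germ U (f.base x) (e hx) ≫ f.stalkMap x := by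
  rw [Scheme.Hom.appLE, Category.assoc, TopCat.Presheaf.germ_res, Scheme.Hom.germ_stalkMap]

/-- **Formal unramifiedness is decided at the closed points of a Jacobson source**: a morphism `f : X ⟶ Y` locally of
finite type whose source is a Jacobson space (e.g. `X` locally of finite type over a field) is formally unramified as soon
as the stalk maps `𝒪_{Y, f x} → 𝒪_{X, x}` at all CLOSED points `x` are formally unramified.  Affine-locally
(`HasRingHomProperty.iff_appLE`) this is `RingHom.FormallyUnramified.of_forall_isMaximal`: a maximal ideal `𝔮` of `Γ(X, V)` is a
closed point `x` of `V`, closed in `X` (Jacobson), `Γ(X,V)_𝔮 ≅ 𝒪_{X,x}` (`IsAffineOpen.isLocalization_stalk'`), and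
`Γ(Y,U) → 𝒪_{X,x}` factors as `Γ(Y,U) → 𝒪_{Y,f x} → 𝒪_{X,x}`, a localisation followed by the stalk map.
[cite: Grothendieck1967, Prop. 17.4.1 and Cor. 17.4.2] [cite: StacksProject, Tags 02G3 and 00UX] -/
theorem formallyUnramified_of_forall_isClosed_stalkMap [LocallyOfFiniteType f] [JacobsonSpace ↥X]
    (H : ∀ x : X, IsClosed ({x} : Set X) → (f.stalkMap x).hom.FormallyUnramified) : FormallyUnramified f := by
  rw [HasRingHomProperty.iff_appLE (P := @FormallyUnramified)]
  intro U V e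
  have hV : IsAffineOpen (V : X.Opens) := V.2
  have hU : IsAffineOpen (U : Y.Opens) := U.2
  -- `Γ(X, V)` is a Jacobson ring: `Spec Γ(X, V) ≅ V` is an open subspace of the Jacobson space `X`
  haveI : JacobsonSpace (PrimeSpectrum Γ(X, ↑V)) :=
    JacobsonSpace.of_isOpenEmbedding (f := hV.fromSpec.base) hV.fromSpec.isOpenEmbedding
  haveI : IsJacobsonRing Γ(X, ↑V) := PrimeSpectrum.isJacobsonRing_iff_jacobsonSpace.mpr inferInstance
  have hft : (f.appLE U V e).hom.FiniteType :=
    HasRingHomProperty.appLE (P := @LocallyOfFiniteType) (f := f) inferInstance U V e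
  refine RingHom.FormallyUnramified.of_forall_isMaximal _ hft @fun q hq => ?_
  -- the closed point `x ∈ V` of the maximal ideal `q`
  let y : PrimeSpectrum Γ(X, ↑V) := ⟨q, hq.isPrime⟩
  let x : X := hV.fromSpec.base y
  have hxV : x ∈ (V : X.Opens) := by
    have hx : x ∈ Set.range ⇑hV.fromSpec := ⟨y, rfl⟩
    rwa [hV.range_fromSpec] at hx
  have hycl : IsClosed ({y} : Set (PrimeSpectrum Γ(X, ↑V))) :=
    (PrimeSpectrum.isClosed_singleton_iff_isMaximal y).mpr hq
  have hxcl : IsClosed ({x} : Set X) := by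
    refine isClosed_singleton_of_isLocallyClosed_singleton ?_
    have himg : IsLocallyClosed (⇑hV.fromSpec '' {y}) :=
      hycl.isLocallyClosed.image hV.fromSpec.isOpenEmbedding.isInducing
        hV.fromSpec.isOpenEmbedding.isOpen_range.isLocallyClosed
    have heq : (⇑hV.fromSpec '' {y}) = ({x} : Set X) := Set.image_singleton
    rwa [heq] at himg
  have hfx : f.base x ∈ (U : Y.Opens) := e hxV
  -- `Γ(Y, U) → Γ(X, V) → 𝒪_{X,x}` is `Γ(Y, U) → 𝒪_{Y, f x} → 𝒪_{X, x}`: a localisation followed by the stalk map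
  have key : ((X.presheaf.germ V x hxV).hom.comp (f.appLE U V e).hom).FormallyUnramified := by
    have hcomp : (X.presheaf.germ V x hxV).hom.comp (f.appLE U V e).hom =
        (f.stalkMap x).hom.comp (Y.presheaf.germ U (f.base x) hfx).hom := by
      rw [← CommRingCat.hom_comp, ← CommRingCat.hom_comp, appLE_comp_germ_eq]
    rw [hcomp]
    refine RingHom.FormallyUnramified.comp ?_ (H x hxcl)
    letI := Y.presheaf.algebra_section_stalk (⟨f.base x, hfx⟩ : (U : Y.Opens))
    haveI := hU.isLocalization_stalk ⟨f.base x, hfx⟩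
    exact RingHom.formallyUnramified_algebraMap.mpr
      (Algebra.FormallyUnramified.of_isLocalization
        (Rₘ := Y.presheaf.stalk (f.base x)) (hU.primeIdealOf ⟨f.base x, hfx⟩).asIdeal.primeCompl)
  -- `𝒪_{X,x}` is the localisation of `Γ(X, V)` at `q`; transport along `Γ(X,V)_q ≃ 𝒪_{X,x}`
  letI := X.presheaf.algebra_section_stalk (⟨x, hxV⟩ : (V : X.Opens))
  haveI : IsLocalization.AtPrime (X.presheaf.stalk x) q := hV.isLocalization_stalk' y hxV
  let eq : Localization.AtPrime q ≃ₐ[Γ(X, ↑V)] X.presheaf.stalk x :=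
    IsLocalization.algEquiv q.primeCompl (Localization.AtPrime q) (X.presheaf.stalk x)
  have hcomp2 : (algebraMap Γ(X, ↑V) (Localization.AtPrime q)).comp (f.appLE U V e).hom =
      eq.symm.toRingEquiv.toRingHom.comp ((X.presheaf.germ V x hxV).hom.comp (f.appLE U V e).hom) := by
    ext a
    change algebraMap Γ(X, ↑V) (Localization.AtPrime q) ((f.appLE U V e).hom a) =
      eq.symm (algebraMap Γ(X, ↑V) (X.presheaf.stalk x) ((f.appLE U V e).hom a))
    rw [AlgEquiv.commutes]
  rw [hcomp2]
  exact RingHom.FormallyUnramified.respectsIso.1 _ eq.symm.toRingEquiv key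

/-- **The closed-point criterion in the form it is used** ([Stacks 02FM]): `f : X ⟶ Y` locally of finite type with
Jacobson source is formally unramified if at every closed point `x`, the residue field extension `κ(x) / κ(f x)` is
separable and `𝔪_{f x} 𝒪_{X,x} = 𝔪_x` (Mathlib `Algebra.FormallyUnramified.of_map_maximalIdeal`).  Over `ℂ` the
separability is automatic (residue fields of closed points of schemes locally of finite type over `ℂ` are `ℂ`), and the
ideal condition says that functions vanishing at `f x` generate the maximal ideal at `x` — the cotangent surjectivity that
an injective differential delivers. [cite: StacksProject, Tag 02FM] [cite: Grothendieck1967, Cor. 17.4.2] -/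
theorem formallyUnramified_of_forall_isClosed_map_maximalIdeal [LocallyOfFiniteType f] [JacobsonSpace ↥X]
    (hres : ∀ x : X, IsClosed ({x} : Set X) →
      Function.Surjective (IsLocalRing.ResidueField.map (f.stalkMap x).hom))
    (H : ∀ x : X, IsClosed ({x} : Set X) →
      (IsLocalRing.maximalIdeal (Y.presheaf.stalk (f.base x))).map (f.stalkMap x).hom =
        IsLocalRing.maximalIdeal (X.presheaf.stalk x)) :
    FormallyUnramified f := by
  refine formallyUnramified_of_forall_isClosed_stalkMap f fun x hx => ?_
  letI : Algebra (Y.presheaf.stalk (f.base x)) (X.presheaf.stalk x) := (f.stalkMap x).hom.toAlgebra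
  haveI : IsLocalHom (algebraMap (Y.presheaf.stalk (f.base x)) (X.presheaf.stalk x)) :=
    inferInstanceAs (IsLocalHom (f.stalkMap x).hom)
  haveI : Algebra.EssFiniteType (Y.presheaf.stalk (f.base x)) (X.presheaf.stalk x) :=
    LocallyOfFiniteType.stalkMap f x
  -- `κ(f x) → κ(x)` is onto, so `κ(x) / κ(f x)` is separable
  haveI : Algebra.IsSeparable (IsLocalRing.ResidueField (Y.presheaf.stalk (f.base x)))
      (IsLocalRing.ResidueField (X.presheaf.stalk x)) := by
    refine ⟨fun l => ?_⟩
    obtain ⟨r', hr'⟩ := hres x hx l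
    obtain ⟨r, rfl⟩ := IsLocalRing.residue_surjective r'
    have hl : l = algebraMap _ _ (IsLocalRing.residue _ r) := by
      rw [← hr', IsLocalRing.ResidueField.algebraMap_residue]
      rfl
    rw [hl]
    exact isSeparable_algebraMap _
  exact Algebra.FormallyUnramified.of_map_maximalIdeal (H x hx)

end Literature.AlgebraicGeometry.Morphisms
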